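import Mathlib
import Summits.KontsevichZagierPeriods.Zeta5Search.Elimination.HalfShiftCasoratian
import Summits.KontsevichZagierPeriods.Zeta5Search.Elimination.PencilConnection
import HarnessLib

/-!
# The half-shift BRIDGE, ungauged (E-L19c, part 2a; fam-elim gen 23)

HONEST FRAMING: systematic search; no irrationality claim unless certified — identities among the rational Taylor data
`D(b) = (U(b), W(b), V(b))` of the Ball–Rivoal family; nothing here is about sizes or irrationality.

gen-1's conjecture node `DictBridge` (g15, `HOME/lean/WedgeDictionaryBridge.lean`) is a four-term relation among the
wedge data at the cluster `{c, c+e₇, Hc, DSc}` (`H = hShift`: level `+1`, slots `{4,5,7}` `+1`; `DS = dsShift`: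
level `+2`, every slot `+1`).  This file proves its ρ-free form: for each slot-7 wedge coordinate
`X ∈ {U∧W, U∧V, V∧W}` (`casUW`, `casUV`, `casVW`, `X(x) = X(D(x) ∧ D(x+e₇))`),

  `A·d·X(DSz) + λ·pr·X(Hz) = λ·A·B₀·X(z) + π_T·d·X(z+e₇)`

(`halfShiftBridge_casUW/_casUV/_casVW`; packaged as `halfShiftBridge` on the interior region), where
`λ = λ₇(z) = (z₇+1)(z₀+1−z₇)` (`dsLam z 6`), `A = meetA z = (z₇+1)(z₀−z₄−z₇)(z₀−z₅−z₇)`, `d = d(z)` (`raiseD`),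
`pr = ∏_{j<k ∈ {1,2,3,6}} (z₀+1−z_j−z_k)` (`raisePr`), `π_T = (z₄+1)(z₅+1)(z₇+1)` (`raisePiT`) and
`B₀ = (z₄+1)(z₅+1)(2z₀−z₁−z₂−z₃−z₆−z₇)` (`bridgeB0`) — all four coefficients are PRODUCTS of linear forms.

Proof (pure multilinear algebra on top of E-L19a/b/c-1 and (DS)): with `f₁,f₂,f₃ = D(z), D(z+e₇), D(z+2e₇)` and
`Δ = cas3 z`, every bivector satisfies `Δ·X(u∧v) = Σ_k det(u,v,f_k)·X(f_{k+1}∧f_{k+2})`; the pairings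
`det(D(Hz),D(Hz+e₇),f_k)` are `−D₀·d·Q·Δ/(Q·pr)`, `−A·d·Q·Δ/(Q·pr)`, `A·Q·B₃·Δ/(Q·pr)` (`tripleDet_meet_z/lo/hi'`
of `HalfShiftCasoratian`), and `D(DSz) = f₂ − λ f₁`, `D(DSz+e₇) = f₃ − λ′ f₂` by (DS) (`dictionary_dsShift7`,
`bump_dsShift`); the three scalar identities that remain are `A = D₀λ + π_T` (`meetA_eq_lam`),
`B₃ = B₀ − λ′·d` (`raiseB3_eq`) and `Θ₃ = d·Q`.  So `Q·pr·Δ·(relation) = 0` is ONE `linear_combination` of the three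
pairing lemmas with cofactor coefficients (`bridge_key_*`; certificate found outside Lean,
`HOME/pub-zeta5-fam-elim/g23/e19/probe46.py`), and `Q·pr·Δ ≠ 0` on the interior (`meetQ_ne_zero`, `raisePr_pos`,
`cas3_ne_zero`).

GAUGE (for the successor, E-L19c part 2b): dividing the four coefficients by the closed-form ratios
`ρ_B(x)/ρ_B(z)` (`x = z+e₇, Hz, DSz`; `HOME/pub-zeta5-fam-elim/g23/e19/probe45.py`) gives exactly gen-1's
`(bridgeBase, bridgeSlot, bridgeHalf, bridgeApex)·(−A·Q·π_T)` (checked at 8 box points), i.e. `DictBridge` on the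
interior is this file plus `ρ_B` bookkeeping as in `Elimination/PencilGauge` / `PencilBridge`.
-/

open Finset

namespace Summit.KontsevichZagierPeriods.Zeta5Search.Elimination

open Summit.KontsevichZagierPeriods.Zeta5Search.DualSeries (InBox)
open Summit.KontsevichZagierPeriods.Zeta5Search.WedgeDictionary

/-- `B₀ = (z₄+1)(z₅+1)(2z₀ − z₁ − z₂ − z₃ − z₆ − z₇)`. -/
def bridgeB0 (z : ℕ → ℤ) : ℚ :=
  ((z 4 : ℚ) + 1) * ((z 5 : ℚ) + 1) * (2 * (z 0 : ℚ) - z 1 - z 2 - z 3 - z 6 - z 7)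

/-- `λ₇(z) = (z₇ + 1)(z₀ − z₇ + 1)`. -/
theorem dsLam_six (z : ℕ → ℤ) : dsLam z 6 = ((z 7 : ℚ) + 1) * ((z 0 : ℚ) - z 7 + 1) := by
  simp only [dsLam, Nat.reduceAdd]

/-- `λ₇(z + e₇) = (z₇ + 2)(z₀ − z₇)`. -/
theorem dsLam_six_bump6 (z : ℕ → ℤ) : dsLam (bump z 6) 6 = ((z 7 : ℚ) + 2) * ((z 0 : ℚ) - z 7) := by
  simp only [dsLam, Nat.reduceAdd, bump6_seven, bump_zero]
  push_cast
  ring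

/-- `A = D₀·λ₇ + π_T`. -/
theorem meetA_eq_lam (z : ℕ → ℤ) : meetA z = meetD0 z * dsLam z 6 + raisePiT z := by
  rw [dsLam_six]
  unfold meetA raisePiT
  ring

/-- `B₃ = B₀ − λ₇(z+e₇)·d`. -/
theorem raiseB3_eq (z : ℕ → ℤ) : raiseB3 z = bridgeB0 z - dsLam (bump z 6) 6 * raiseD z := by
  rw [dsLam_six_bump6]
  unfold raiseB3 bridgeB0
  ring

/-- `pr > 0` when the pair sums are at most `z₀`. -/
theorem raisePr_pos (z : ℕ → ℤ) (hp : ∀ jk ∈ allPairs, z jk.1 + z jk.2 ≤ z 0) : 0 < raisePr z := by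
  have h12 : (z 1 : ℚ) + z 2 ≤ z 0 := by exact_mod_cast hp (1, 2) (by decide)
  have h13 : (z 1 : ℚ) + z 3 ≤ z 0 := by exact_mod_cast hp (1, 3) (by decide)
  have h16 : (z 1 : ℚ) + z 6 ≤ z 0 := by exact_mod_cast hp (1, 6) (by decide)
  have h23 : (z 2 : ℚ) + z 3 ≤ z 0 := by exact_mod_cast hp (2, 3) (by decide)
  have h26 : (z 2 : ℚ) + z 6 ≤ z 0 := by exact_mod_cast hp (2, 6) (by decide)
  have h36 : (z 3 : ℚ) + z 6 ≤ z 0 := by exact_mod_cast hp (3, 6) (by decide)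
  unfold raisePr
  exact mul_pos (mul_pos (mul_pos (mul_pos (mul_pos (by linarith) (by linarith)) (by linarith)) (by linarith))
    (by linarith)) (by linarith)

/-! ### The key combination, one wedge coordinate at a time -/

/-- `Q·pr·cas3(z)·[A·d·X(DSz) + λ·pr·X(Hz) − λ·A·B₀·X(z) − π_T·d·X(z+e₇)] = 0` for `X = U∧W`. -/
theorem bridge_key_UW (z : ℕ → ℤ) (hz : InBox z) (hd : 1 ≤ dOf z) (h7 : z 7 + 1 ≤ z 0) :
    meetQ z * raisePr z * cas3 z *
        (meetA z * raiseD z * casUW (dsShift z) + dsLam z 6 * raisePr z * casUW (hShift z) -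
          (dsLam z 6 * meetA z * bridgeB0 z * casUW z + raisePiT z * raiseD z * casUW (bump z 6))) = 0 := by
  have hz1 := tripleDet_meet_z z hz hd h7
  have hlo := tripleDet_meet_lo z hz hd h7
  have hhi := tripleDet_meet_hi' z hz hd h7
  have hb1 : InBox (bump z 6) := inBox_bump6 z hz (by omega)
  have hd1 : dOf (bump z 6) = dOf z - 1 := dOf_bump z (mem_range.2 (by norm_num))
  obtain ⟨dU0, dW0, -⟩ := dictionary_dsShift7 z hz (by omega) (by omega)
  obtain ⟨dU1, dW1, -⟩ :=
    dictionary_dsShift7 (bump z 6) hb1 (by rw [hd1]; omega) (by rw [bump6_seven, bump_zero]; omega)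
  rw [meetA_eq_lam] at hlo hhi ⊢
  rw [raiseB3_eq] at hhi
  unfold raiseTh3 at hz1 hlo
  unfold casUW
  rw [bump_dsShift, dU0, dW0, dU1, dW1]
  unfold tripleDet at hz1 hlo hhi
  unfold cas3 at hz1 hlo hhi ⊢
  linear_combination (dsLam z 6 * raisePr z * (coeffU (bump z 6) * coeffW (bump (bump z 6) 6) - coeffU (bump (bump z 6) 6) * coeffW (bump z 6))) * hz1 +
    (dsLam z 6 * raisePr z * (coeffU (bump (bump z 6) 6) * coeffW z - coeffU z * coeffW (bump (bump z 6) 6))) * hlo +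
    (dsLam z 6 * raisePr z * (coeffU z * coeffW (bump z 6) - coeffU (bump z 6) * coeffW z)) * hhi

/-- **Half-shift BRIDGE, `U∧W` coordinate (ungauged)**: `A·d·X(DSz) + λ·pr·X(Hz) = λ·A·B₀·X(z) + π_T·d·X(z+e₇)`
whenever `Q·pr·cas3(z) ≠ 0`. -/
theorem halfShiftBridge_casUW (z : ℕ → ℤ) (hz : InBox z) (hd : 1 ≤ dOf z) (h7 : z 7 + 1 ≤ z 0)
    (hQ : meetQ z ≠ 0) (hpr : raisePr z ≠ 0) (hc : cas3 z ≠ 0) :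
    meetA z * raiseD z * casUW (dsShift z) + dsLam z 6 * raisePr z * casUW (hShift z) =
      dsLam z 6 * meetA z * bridgeB0 z * casUW z + raisePiT z * raiseD z * casUW (bump z 6) :=
  sub_eq_zero.1 ((mul_eq_zero.1 (bridge_key_UW z hz hd h7)).resolve_left (mul_ne_zero (mul_ne_zero hQ hpr) hc))

/-- `Q·pr·cas3(z)·[A·d·X(DSz) + λ·pr·X(Hz) − λ·A·B₀·X(z) − π_T·d·X(z+e₇)] = 0` for `X = U∧V`. -/
theorem bridge_key_UV (z : ℕ → ℤ) (hz : InBox z) (hd : 1 ≤ dOf z) (h7 : z 7 + 1 ≤ z 0) :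
    meetQ z * raisePr z * cas3 z *
        (meetA z * raiseD z * casUV (dsShift z) + dsLam z 6 * raisePr z * casUV (hShift z) -
          (dsLam z 6 * meetA z * bridgeB0 z * casUV z + raisePiT z * raiseD z * casUV (bump z 6))) = 0 := by
  have hz1 := tripleDet_meet_z z hz hd h7
  have hlo := tripleDet_meet_lo z hz hd h7
  have hhi := tripleDet_meet_hi' z hz hd h7
  have hb1 : InBox (bump z 6) := inBox_bump6 z hz (by omega)
  have hd1 : dOf (bump z 6) = dOf z - 1 := dOf_bump z (mem_range.2 (by norm_num))
  obtain ⟨dU0, -, dV0⟩ := dictionary_dsShift7 z hz (by omega) (by omega)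
  obtain ⟨dU1, -, dV1⟩ :=
    dictionary_dsShift7 (bump z 6) hb1 (by rw [hd1]; omega) (by rw [bump6_seven, bump_zero]; omega)
  rw [meetA_eq_lam] at hlo hhi ⊢
  rw [raiseB3_eq] at hhi
  unfold raiseTh3 at hz1 hlo
  unfold casUV
  rw [bump_dsShift, dU0, dV0, dU1, dV1]
  unfold tripleDet at hz1 hlo hhi
  unfold cas3 at hz1 hlo hhi ⊢
  linear_combination (dsLam z 6 * raisePr z * (coeffU (bump z 6) * coeffV (bump (bump z 6) 6) - coeffU (bump (bump z 6) 6) * coeffV (bump z 6))) * hz1 +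
    (dsLam z 6 * raisePr z * (coeffU (bump (bump z 6) 6) * coeffV z - coeffU z * coeffV (bump (bump z 6) 6))) * hlo +
    (dsLam z 6 * raisePr z * (coeffU z * coeffV (bump z 6) - coeffU (bump z 6) * coeffV z)) * hhi

/-- **Half-shift BRIDGE, `U∧V` coordinate (ungauged)**: `A·d·X(DSz) + λ·pr·X(Hz) = λ·A·B₀·X(z) + π_T·d·X(z+e₇)`
whenever `Q·pr·cas3(z) ≠ 0`. -/
theorem halfShiftBridge_casUV (z : ℕ → ℤ) (hz : InBox z) (hd : 1 ≤ dOf z) (h7 : z 7 + 1 ≤ z 0)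
    (hQ : meetQ z ≠ 0) (hpr : raisePr z ≠ 0) (hc : cas3 z ≠ 0) :
    meetA z * raiseD z * casUV (dsShift z) + dsLam z 6 * raisePr z * casUV (hShift z) =
      dsLam z 6 * meetA z * bridgeB0 z * casUV z + raisePiT z * raiseD z * casUV (bump z 6) :=
  sub_eq_zero.1 ((mul_eq_zero.1 (bridge_key_UV z hz hd h7)).resolve_left (mul_ne_zero (mul_ne_zero hQ hpr) hc))

/-- `Q·pr·cas3(z)·[A·d·X(DSz) + λ·pr·X(Hz) − λ·A·B₀·X(z) − π_T·d·X(z+e₇)] = 0` for `X = V∧W`. -/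
theorem bridge_key_VW (z : ℕ → ℤ) (hz : InBox z) (hd : 1 ≤ dOf z) (h7 : z 7 + 1 ≤ z 0) :
    meetQ z * raisePr z * cas3 z *
        (meetA z * raiseD z * casVW (dsShift z) + dsLam z 6 * raisePr z * casVW (hShift z) -
          (dsLam z 6 * meetA z * bridgeB0 z * casVW z + raisePiT z * raiseD z * casVW (bump z 6))) = 0 := by
  have hz1 := tripleDet_meet_z z hz hd h7
  have hlo := tripleDet_meet_lo z hz hd h7
  have hhi := tripleDet_meet_hi' z hz hd h7
  have hb1 : InBox (bump z 6) := inBox_bump6 z hz (by omega)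
  have hd1 : dOf (bump z 6) = dOf z - 1 := dOf_bump z (mem_range.2 (by norm_num))
  obtain ⟨-, dW0, dV0⟩ := dictionary_dsShift7 z hz (by omega) (by omega)
  obtain ⟨-, dW1, dV1⟩ :=
    dictionary_dsShift7 (bump z 6) hb1 (by rw [hd1]; omega) (by rw [bump6_seven, bump_zero]; omega)
  rw [meetA_eq_lam] at hlo hhi ⊢
  rw [raiseB3_eq] at hhi
  unfold raiseTh3 at hz1 hlo
  unfold casVW
  rw [bump_dsShift, dW0, dV0, dW1, dV1]
  unfold tripleDet at hz1 hlo hhi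
  unfold cas3 at hz1 hlo hhi ⊢
  linear_combination (dsLam z 6 * raisePr z * (coeffV (bump z 6) * coeffW (bump (bump z 6) 6) - coeffV (bump (bump z 6) 6) * coeffW (bump z 6))) * hz1 +
    (dsLam z 6 * raisePr z * (coeffV (bump (bump z 6) 6) * coeffW z - coeffV z * coeffW (bump (bump z 6) 6))) * hlo +
    (dsLam z 6 * raisePr z * (coeffV z * coeffW (bump z 6) - coeffV (bump z 6) * coeffW z)) * hhi

/-- **Half-shift BRIDGE, `V∧W` coordinate (ungauged)**: `A·d·X(DSz) + λ·pr·X(Hz) = λ·A·B₀·X(z) + π_T·d·X(z+e₇)`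
whenever `Q·pr·cas3(z) ≠ 0`. -/
theorem halfShiftBridge_casVW (z : ℕ → ℤ) (hz : InBox z) (hd : 1 ≤ dOf z) (h7 : z 7 + 1 ≤ z 0)
    (hQ : meetQ z ≠ 0) (hpr : raisePr z ≠ 0) (hc : cas3 z ≠ 0) :
    meetA z * raiseD z * casVW (dsShift z) + dsLam z 6 * raisePr z * casVW (hShift z) =
      dsLam z 6 * meetA z * bridgeB0 z * casVW z + raisePiT z * raiseD z * casVW (bump z 6) :=
  sub_eq_zero.1 ((mul_eq_zero.1 (bridge_key_VW z hz hd h7)).resolve_left (mul_ne_zero (mul_ne_zero hQ hpr) hc))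

/-! ### The interior package -/

/-- **The half-shift BRIDGE on the interior region** (all three wedge coordinates): for `z` in the box with
`d(z) ≥ 1`, `z₇ + 2 ≤ z₀` and all pair sums `z_j + z_k ≤ z₀` (then `Q`, `pr`, `cas3 z ≠ 0` automatically),
`A·d·X(DSz) + λ·pr·X(Hz) = λ·A·B₀·X(z) + π_T·d·X(z+e₇)` for `X = U∧W, U∧V, V∧W`. -/
theorem halfShiftBridge (z : ℕ → ℤ) (hz : InBox z) (hd : 1 ≤ dOf z) (h7 : z 7 + 2 ≤ z 0)
    (hp : ∀ jk ∈ allPairs, z jk.1 + z jk.2 ≤ z 0) :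
    (meetA z * raiseD z * casUW (dsShift z) + dsLam z 6 * raisePr z * casUW (hShift z) =
        dsLam z 6 * meetA z * bridgeB0 z * casUW z + raisePiT z * raiseD z * casUW (bump z 6)) ∧
      (meetA z * raiseD z * casUV (dsShift z) + dsLam z 6 * raisePr z * casUV (hShift z) =
          dsLam z 6 * meetA z * bridgeB0 z * casUV z + raisePiT z * raiseD z * casUV (bump z 6)) ∧
        (meetA z * raiseD z * casVW (dsShift z) + dsLam z 6 * raisePr z * casVW (hShift z) =
            dsLam z 6 * meetA z * bridgeB0 z * casVW z + raisePiT z * raiseD z * casVW (bump z 6)) := by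
  have h12 := hp (1, 2) (by decide)
  have h36 := hp (3, 6) (by decide)
  have hQ : meetQ z ≠ 0 := meetQ_ne_zero z (by simp only at h12 h36; omega)
  have hpr : raisePr z ≠ 0 := (raisePr_pos z hp).ne'
  have hc : cas3 z ≠ 0 := cas3_ne_zero z hz h7 hd hp
  exact ⟨halfShiftBridge_casUW z hz hd (by omega) hQ hpr hc, halfShiftBridge_casUV z hz hd (by omega) hQ hpr hc,
    halfShiftBridge_casVW z hz hd (by omega) hQ hpr hc⟩

end Summit.KontsevichZagierPeriods.Zeta5Search.Elimination
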